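import Summits.Schanuel.Schanuel.Theorems.RootDecomp1KW4Coprime01

/-! PORT (census-1 g29, ×0 RECORD PORT of the census kernel scratch W4Coprime.lean 0f91a57d…; RAMIF-v1 (B) NOTE 72 L3351, crit audit L3352,
 NOTE 74 L3363, writer NOTE 21 L3364, crit ACK + PORT GO L3366 «×0 RECORD, NODE-34 TERMS») — part 2 of 2 (RootDecomp1KW4Coprime02): §5 the real
 size bookkeeping `size_bound` (`c⁶ ≤ K·b⁴`) and the HEADLINE `clause_two_W4P_coprimeClass`. PORT EDIT (m2): `isCoprime_num_den` as a PRIVATE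
 copy here (verbatim twin of `Literature.NumberTheory.DiophantineApproximation.SparseDyadicRationals.isCoprime_num_den`; LevelFinite precedent);
 everything else VERBATIM from the scratch. `--supports stmt-Schanuel-33364`; no census credit; ×0 record port; does NOT prove `ThinFibreAt 2 W4P`
 / `LevelFinite W4P` / stmt-Schanuel-33364; row 36 UNDECIDED OF RECORD. -/

/-!
# RootDecomp1KW4Coprime — part 2: sizes and the clause on the coprime class

HEADLINE `clause_two_W4P_coprimeClass (C : ℝ) : ∃ N₀, ∀ N ≥ N₀, ∀ r : ℚ, |r| ≤ C → bev W4P (partialSum 2 N) r = 0 →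
∀ c : ℤ, (psNumer 2 N : ℤ) = r.den * c → IsCoprime (r.den : ℤ) c → C * 2 ^ (N + 1)! < (r.den : ℝ) ^ (2 * N)` — the clause of the
tree's `ThinFibreAt 2 W4P` (RootDecomp1KDegreeLadder06; the non-degeneracy proviso is not needed) restricted by the two
coprime-class binders.  A PARTIAL, hypothesis-free, elementary statement: it does NOT decide `ThinFibreAt 2 W4P` (the class of level
points whose denominator meets `p_N` at a prime `q` with `q² ∣ p_N` is untouched), moves no binder (`PadicSubspace` of record), rung 0.
-/

noncomputable section

open Polynomial LiouvilleNumber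
open scoped Nat

namespace Summit.Schanuel.Schanuel.Theorems.RootDecomp1KW4Coprime

open Summit.Schanuel.Schanuel.Theorems.RootDecomp1KTwoBaseCell (psNumer partialSum_eq_psNumer_div coprime_psNumer)
open Summit.Schanuel.Schanuel.Theorems.RootDecomp1KDegreeLadder
open Summit.Schanuel.Schanuel.Theorems.RootDecomp1KOddEmpty
open Summit.Schanuel.Schanuel.Theorems.RootDecomp1KRunge (runge_arith psNumer_pos_runge)

/-! ### §5 Sizes and the clause on the coprime class -/

/-- the real size bookkeeping: from the integer structure and `|a| ≤ C₀·b`, `T ≤ p = bc`: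
`c⁶ ≤ K·b⁴` with `K = K₅³ + K₃²`, `K₁ = (C₀+2)² + (C₀+2) + 7`, `K₅ = 83(C₀+2) + 7K₁`,
`K₃ = K₁² + 12(C₀+2)K₁ + 81(C₀+2)²`. -/
theorem size_bound {a b c T j m : ℤ} {C₀ : ℝ} (hC₀ : 0 ≤ C₀) (hb : 0 < b) (hc : 0 < c)
    (hT0 : 0 < T) (hTp : T ≤ b * c) (haC : |(a : ℝ)| ≤ C₀ * b) (hj0 : j ≠ 0) (hjc : a + 2 * b = j * c)
    (hm : m * (b * c) = j ^ 2 * c ^ 2 + j * T - 7 * b ^ 2) (hbc : IsCoprime b c) (hH : Hint j m b c = 0) :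
    ((c : ℝ)) ^ 6 ≤ ((83 * (C₀ + 2) + 7 * ((C₀ + 2) ^ 2 + (C₀ + 2) + 7)) ^ 3 +
        (((C₀ + 2) ^ 2 + (C₀ + 2) + 7) ^ 2 + 12 * (C₀ + 2) * ((C₀ + 2) ^ 2 + (C₀ + 2) + 7) +
          81 * (C₀ + 2) ^ 2) ^ 2) * (b : ℝ) ^ 4 := by
  set K₁ : ℝ := (C₀ + 2) ^ 2 + (C₀ + 2) + 7 with hK₁
  set K₅ : ℝ := 83 * (C₀ + 2) + 7 * K₁ with hK₅
  set K₃ : ℝ := K₁ ^ 2 + 12 * (C₀ + 2) * K₁ + 81 * (C₀ + 2) ^ 2 with hK₃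
  have hK₁0 : 0 ≤ K₁ := by positivity
  have hK₅0 : 0 ≤ K₅ := by positivity
  have hK₃0 : 0 ≤ K₃ := by positivity
  have hbR : (0 : ℝ) < b := by exact_mod_cast hb
  have hcR : (0 : ℝ) < c := by exact_mod_cast hc
  have hb1 : (1 : ℝ) ≤ b := by exact_mod_cast hb
  have hTR : (0 : ℝ) < T := by exact_mod_cast hT0
  have hTpR : (T : ℝ) ≤ b * c := by exact_mod_cast hTp
  -- u = j·c, v = m·c as reals
  set u : ℝ := (j : ℝ) * c with hu
  set v : ℝ := (m : ℝ) * c with hv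
  set A : ℝ := (C₀ + 2) * b with hA
  set B : ℝ := K₁ * b with hB
  clear_value u v A B
  have hA0 : 0 ≤ A := by rw [hA]; positivity
  have hB0 : 0 ≤ B := by rw [hB]; positivity
  have hjcR : u = a + 2 * b := by rw [hu]; exact_mod_cast hjc.symm
  have hU : |u| ≤ A := by
    rw [hjcR, hA]
    have h2b : |(2 : ℝ) * b| = 2 * b := abs_of_pos (by positivity)
    calc |(a : ℝ) + 2 * b| ≤ |(a : ℝ)| + |(2 : ℝ) * b| := abs_add_le _ _
      _ ≤ C₀ * b + 2 * b := by rw [h2b]; linarith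
      _ = (C₀ + 2) * b := by ring
  have huc : |u| = |(j : ℝ)| * c := by rw [hu, abs_mul, abs_of_pos hcR]
  -- |v| ≤ B
  have hmR : (m : ℝ) * (b * c) = j ^ 2 * c ^ 2 + j * T - 7 * b ^ 2 := by exact_mod_cast hm
  have hV : |v| ≤ B := by
    have h1 : |v| * b ≤ K₁ * b ^ 2 := by
      have e : |v| * b = |(j : ℝ) ^ 2 * c ^ 2 + j * T - 7 * b ^ 2| := by
        rw [← hmR, hv, abs_mul (m : ℝ) ((b : ℝ) * c), abs_mul (b : ℝ) (c : ℝ), abs_mul (m : ℝ) (c : ℝ),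
          abs_of_pos hbR, abs_of_pos hcR]; ring
      rw [e]
      have hjT : |(j : ℝ) * T| ≤ A * b := by
        rw [abs_mul, abs_of_pos hTR]
        calc |(j : ℝ)| * T ≤ |(j : ℝ)| * (b * c) := mul_le_mul_of_nonneg_left hTpR (abs_nonneg _)
          _ = (|(j : ℝ)| * c) * b := by ring
          _ ≤ A * b := by rw [← huc]; exact mul_le_mul_of_nonneg_right hU hbR.le
      have hjc2 : |(j : ℝ) ^ 2 * c ^ 2| ≤ A ^ 2 := by
        rw [show (j : ℝ) ^ 2 * c ^ 2 = u ^ 2 by rw [hu]; ring, abs_pow u 2]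
        exact pow_le_pow_left₀ (abs_nonneg _) hU 2
      have h7 : |(7 : ℝ) * b ^ 2| = 7 * b ^ 2 := abs_of_pos (by positivity)
      calc |(j : ℝ) ^ 2 * c ^ 2 + j * T - 7 * b ^ 2|
          ≤ |(j : ℝ) ^ 2 * c ^ 2 + j * T| + |(7 : ℝ) * b ^ 2| := abs_sub _ _
        _ ≤ |(j : ℝ) ^ 2 * c ^ 2| + |(j : ℝ) * T| + |(7 : ℝ) * b ^ 2| := by
            linarith [abs_add_le ((j : ℝ) ^ 2 * c ^ 2) (j * T)]
        _ ≤ A ^ 2 + A * b + 7 * b ^ 2 := by rw [h7]; linarith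
        _ = K₁ * b ^ 2 := by rw [hA, hK₁]; ring
    have h2 : |v| * b ≤ B * b := by rw [hB]; nlinarith
    exact le_of_mul_le_mul_right h2 hbR
  have hU0 : 0 ≤ |u| := abs_nonneg _
  have hV0 : 0 ≤ |v| := abs_nonneg _
  -- the two trailing-coefficient cases
  rcases trailing_dvd hj0 hc hbc hH with ⟨hne, hdvd⟩ | ⟨h0, hne, hdvd⟩
  · -- c ≤ |83j + 7m| ⇒ c² ≤ K₅ b ⇒ c⁶ ≤ K₅³ b³ ≤ K₅³ b⁴
    have hle : c ≤ |83 * j + 7 * m| := Int.le_of_dvd (abs_pos.mpr hne) ((dvd_abs _ _).mpr hdvd)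
    have hleR : (c : ℝ) ≤ |(83 : ℝ) * j + 7 * m| := by
      have := (Int.cast_le (R := ℝ)).mpr hle
      push_cast at this
      exact this
    have hc2 : (c : ℝ) ^ 2 ≤ K₅ * b := by
      have e : |(83 : ℝ) * j + 7 * m| * c = |83 * u + 7 * v| := by
        have h' : 83 * u + 7 * v = ((83 : ℝ) * j + 7 * m) * c := by rw [hu, hv]; ring
        rw [h', abs_mul _ (c : ℝ), abs_of_pos hcR]
      calc (c : ℝ) ^ 2 = c * c := by ring
        _ ≤ |(83 : ℝ) * j + 7 * m| * c := mul_le_mul_of_nonneg_right hleR hcR.le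
        _ = |83 * u + 7 * v| := e
        _ ≤ |83 * u| + |7 * v| := abs_add_le _ _
        _ = 83 * |u| + 7 * |v| := by
            rw [abs_mul (83 : ℝ) u, abs_mul (7 : ℝ) v, abs_of_pos (by norm_num : (0:ℝ) < 83),
              abs_of_pos (by norm_num : (0:ℝ) < 7)]
        _ ≤ 83 * A + 7 * B := by linarith
        _ = K₅ * b := by rw [hA, hB, hK₅]; ring
    have hc6 : (c : ℝ) ^ 6 ≤ K₅ ^ 3 * b ^ 3 := by
      have := pow_le_pow_left₀ (by positivity) hc2 3
      rw [← pow_mul, mul_pow] at this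
      exact this
    have hb34 : K₅ ^ 3 * (b : ℝ) ^ 3 ≤ K₅ ^ 3 * b ^ 4 :=
      mul_le_mul_of_nonneg_left (pow_le_pow_right₀ hb1 (by norm_num)) (by positivity)
    have hK3b : (0 : ℝ) ≤ K₃ ^ 2 * b ^ 4 := by positivity
    calc (c : ℝ) ^ 6 ≤ K₅ ^ 3 * b ^ 4 := hc6.trans hb34
      _ ≤ (K₅ ^ 3 + K₃ ^ 2) * b ^ 4 := by rw [add_mul]; linarith
  · -- c ≤ |h₁| ⇒ c³ ≤ K₃ b² ⇒ c⁶ ≤ K₃² b⁴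
    have hle : c ≤ |m ^ 2 + 12 * j * m - 81 * j ^ 2| :=
      Int.le_of_dvd (abs_pos.mpr hne) ((dvd_abs _ _).mpr hdvd)
    have hleR : (c : ℝ) ≤ |(m : ℝ) ^ 2 + 12 * j * m - 81 * j ^ 2| := by
      have := (Int.cast_le (R := ℝ)).mpr hle
      push_cast at this
      exact this
    have hc3 : (c : ℝ) ^ 3 ≤ K₃ * b ^ 2 := by
      have e : |(m : ℝ) ^ 2 + 12 * j * m - 81 * j ^ 2| * (c : ℝ) ^ 2 = |v ^ 2 + 12 * (u * v) - 81 * u ^ 2| := by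
        have h' : v ^ 2 + 12 * (u * v) - 81 * u ^ 2 = ((m : ℝ) ^ 2 + 12 * j * m - 81 * j ^ 2) * (c : ℝ) ^ 2 := by
          rw [hu, hv]; ring
        rw [h', abs_mul _ ((c : ℝ) ^ 2), abs_of_pos (by positivity : (0 : ℝ) < (c : ℝ) ^ 2)]
      have p1 : |v| ^ 2 ≤ B ^ 2 := pow_le_pow_left₀ hV0 hV 2
      have p2 : |u| * |v| ≤ A * B := mul_le_mul hU hV hV0 hA0
      have p3 : |u| ^ 2 ≤ A ^ 2 := pow_le_pow_left₀ hU0 hU 2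
      calc (c : ℝ) ^ 3 = (c : ℝ) * (c : ℝ) ^ 2 := by ring
        _ ≤ |(m : ℝ) ^ 2 + 12 * j * m - 81 * j ^ 2| * (c : ℝ) ^ 2 :=
            mul_le_mul_of_nonneg_right hleR (by positivity)
        _ = |v ^ 2 + 12 * (u * v) - 81 * u ^ 2| := e
        _ ≤ |v ^ 2 + 12 * (u * v)| + |81 * u ^ 2| := abs_sub _ _
        _ ≤ |v ^ 2| + |12 * (u * v)| + |81 * u ^ 2| := by linarith [abs_add_le (v ^ 2) (12 * (u * v))]
        _ = |v| ^ 2 + 12 * (|u| * |v|) + 81 * |u| ^ 2 := by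
            rw [abs_pow v 2, abs_mul 12 (u * v), abs_mul u v, abs_mul 81 (u ^ 2), abs_pow u 2,
              abs_of_pos (by norm_num : (0:ℝ) < 12), abs_of_pos (by norm_num : (0:ℝ) < 81)]
        _ ≤ B ^ 2 + 12 * (A * B) + 81 * A ^ 2 := by linarith
        _ = K₃ * b ^ 2 := by rw [hA, hB, hK₃]; ring
    have hc6 : (c : ℝ) ^ 6 ≤ K₃ ^ 2 * b ^ 4 := by
      have := pow_le_pow_left₀ (by positivity) hc3 2
      rw [← pow_mul, mul_pow, ← pow_mul] at this
      exact this
    have hK5b : (0 : ℝ) ≤ K₅ ^ 3 * b ^ 4 := by positivity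
    calc (c : ℝ) ^ 6 ≤ K₃ ^ 2 * b ^ 4 := hc6
      _ ≤ (K₅ ^ 3 + K₃ ^ 2) * b ^ 4 := by rw [add_mul]; linarith

/-- `num r` and `den r` are coprime in `ℤ` (private copy; verbatim twin of
`Literature.NumberTheory.DiophantineApproximation.SparseDyadicRationals.isCoprime_num_den`). -/
private theorem isCoprime_num_den (r : ℚ) : IsCoprime r.num (r.den : ℤ) := by
  rw [Int.isCoprime_iff_gcd_eq_one, Int.gcd_eq_natAbs]
  simpa using r.reduced

/-- **The `m₀ = 2` thin-fibre clause for `W4P` on the COPRIME CLASS** (hypothesis-free, elementary): for every `C`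
there is `N₀` such that at every level `N ≥ N₀`, every rational `r` with `|r| ≤ C` on the level curve
`W4P(s_N, r) = 0` whose denominator divides `p_N = psNumer 2 N` with a cofactor `c` COPRIME to it satisfies
`C·2^{(N+1)!} < (den r)^{2N}` — the clause of `ThinFibreAt 2 W4P` (the non-degeneracy proviso is not needed). -/
theorem clause_two_W4P_coprimeClass (C : ℝ) :
    ∃ N₀ : ℕ, ∀ N : ℕ, N₀ ≤ N → ∀ r : ℚ, |(r : ℝ)| ≤ C → bev W4P (partialSum 2 N) r = 0 →
      ∀ c : ℤ, (psNumer 2 N : ℤ) = r.den * c → IsCoprime (r.den : ℤ) c →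
        C * 2 ^ (N + 1)! < (r.den : ℝ) ^ (2 * N) := by
  set C₀ : ℝ := max C 0 with hC₀
  have hC₀0 : 0 ≤ C₀ := le_max_right _ _
  have hCC₀ : C ≤ C₀ := le_max_left _ _
  set K : ℝ := (83 * (C₀ + 2) + 7 * ((C₀ + 2) ^ 2 + (C₀ + 2) + 7)) ^ 3 +
        (((C₀ + 2) ^ 2 + (C₀ + 2) + 7) ^ 2 + 12 * (C₀ + 2) * ((C₀ + 2) ^ 2 + (C₀ + 2) + 7) +
          81 * (C₀ + 2) ^ 2) ^ 2 with hK
  obtain ⟨N₂, hN₂⟩ := runge_arith K C 10 2 6 0 (by norm_num)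
  refine ⟨max N₂ 2, fun N hN r hrC hP c hpc hcop => ?_⟩
  have hN2 : 2 ≤ N := le_trans (le_max_right _ _) hN
  have hNN₂ : N₂ ≤ N := le_trans (le_max_left _ _) hN
  have hb0 : (0 : ℤ) < r.den := by exact_mod_cast r.den_pos
  have hp0 : (0 : ℤ) < psNumer 2 N := by exact_mod_cast psNumer_pos_runge N
  have hT0 : (0 : ℤ) < 2 ^ N ! := by positivity
  have hc0 : 0 < c := by
    rcases lt_trichotomy c 0 with h | h | h
    · exfalso; have : (r.den : ℤ) * c < 0 := mul_neg_of_pos_of_neg hb0 h; linarith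
    · exfalso; rw [h, mul_zero] at hpc; linarith
    · exact h
  have hE : levelE r.num r.den ((r.den : ℤ) * c) (2 ^ N !) = 0 := by
    rw [← hpc]; exact levelE_eq_zero hP
  have hab : IsCoprime r.num (r.den : ℤ) := isCoprime_num_den r
  have hp2 : IsCoprime (psNumer 2 N : ℤ) (2 : ℤ) := by
    have h := Nat.isCoprime_iff_coprime.mpr (coprime_psNumer 2 hN2)
    exact_mod_cast h
  have hcT : IsCoprime c ((2 : ℤ) ^ N !) := by
    rw [hpc] at hp2
    exact (IsCoprime.of_mul_left_right hp2).pow_right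
  obtain ⟨j, m, hj0, hjc, hm, hH⟩ := structure_of_level hb0 hc0 hT0 hE hcop hab hcT
  -- sizes
  have hbR : (0 : ℝ) < (r.den : ℤ) := by exact_mod_cast hb0
  have haC : |((r.num : ℤ) : ℝ)| ≤ C₀ * ((r.den : ℤ) : ℝ) := by
    have e : (r : ℝ) = (r.num : ℝ) / (r.den : ℝ) := by rw [Rat.cast_def]
    have h1 : |(r : ℝ)| ≤ C₀ := hrC.trans hCC₀
    rw [e, abs_div] at h1
    have hden : |((r.den : ℕ) : ℝ)| = ((r.den : ℤ) : ℝ) := by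
      rw [abs_of_pos (by exact_mod_cast r.den_pos)]; norm_cast
    rw [hden] at h1
    have := (div_le_iff₀ hbR).mp h1
    simpa using this
  have hTp : (2 : ℤ) ^ N ! ≤ (r.den : ℤ) * c := by
    rw [← hpc]; exact_mod_cast two_pow_le_psNumer (by omega : 1 ≤ N)
  have hc6 := size_bound hC₀0 hb0 hc0 hT0 hTp haC hj0 hjc hm hcop hH
  -- 2^{6·N!} ≤ K·den^10
  have hd1 : 1 ≤ r.den := r.den_pos
  have hmain : (2 : ℝ) ^ ((6 - 0) * N !) ≤ K * (r.den : ℝ) ^ 10 := by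
    have hp6 : ((2 : ℝ) ^ N !) ^ 6 ≤ (((r.den : ℤ) : ℝ) * c) ^ 6 := by
      refine pow_le_pow_left₀ (by positivity) ?_ 6
      exact_mod_cast hTp
    have hdR : ((r.den : ℤ) : ℝ) = (r.den : ℝ) := by norm_cast
    calc (2 : ℝ) ^ ((6 - 0) * N !) = ((2 : ℝ) ^ N !) ^ 6 := by rw [Nat.sub_zero, mul_comm, pow_mul]
      _ ≤ (((r.den : ℤ) : ℝ) * c) ^ 6 := hp6
      _ = ((r.den : ℤ) : ℝ) ^ 6 * (c : ℝ) ^ 6 := by ring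
      _ ≤ ((r.den : ℤ) : ℝ) ^ 6 * (K * ((r.den : ℤ) : ℝ) ^ 4) := by
          rw [hK]; exact mul_le_mul_of_nonneg_left hc6 (by positivity)
      _ = K * (r.den : ℝ) ^ 10 := by rw [hdR]; ring
  exact hN₂ N hNN₂ r.den hd1 hmain

end Summit.Schanuel.Schanuel.Theorems.RootDecomp1KW4Coprime

end
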